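import Literature.AlgebraicGeometry.Morphisms.CechUnitCocycleTwoFaceTower
import Literature.AlgebraicGeometry.Morphisms.CechUnitCocycleBaseChangeModelData
import Literature.AlgebraicGeometry.Morphisms.CechUnitCocycleSteinModels
import Literature.AlgebraicGeometry.Morphisms.CechUnitCocycleFramesToolkit
import Literature.AlgebraicGeometry.Motives.KunnethH1FibreRingRestrictBase
import Literature.RingTheory.Flat.SmallExtensionPowQuot
import Literature.AlgebraicGeometry.AbelianSchemes.RigidifiedLineBundleComap
import HarnessLib

/-!
# Step (I) of the theorem of the cube over a noetherian LOCAL base, for line bundles (Görtz–Wedhorn II, Lemma 24.72 Step (I))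

Layer `Literature/AlgebraicGeometry/Motives`, namespace `Literature.AlgebraicGeometry.Motives`.  THEOREMS ONLY (no definition, no
named fact, no instance, no notation).  Cell `hodgecm-mathlib` (D-0151), F-2d road (R-def) «theorem of the cube over a NON-reduced
base», brick D5b-β (author B-p07 (g16)): the assembly of the cocycle Step (I) (★ `Morphisms/CechUnitCocycleTwoFaceTower`) with its
dictionary (★ Č4b `…BaseChangeModelData`) and the discharges of its abstract hypotheses (★ Č4d `…SteinModels`, ★ Č4e
`Motives/KunnethH1FibreRingRestrictBase`, ★ D5a `RingTheory/Flat/SmallExtensionPowQuot`, ★ D5b-α `…FramesToolkit`) into a statement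
about LINE BUNDLES:

**`cubeStepI_localRing`.**  Let `(A, 𝔪, κ)` be a noetherian local ring, `X`, `Y` flat `A`-schemes with `X ×_A Y` separated and
quasi-compact, with sections `x`, `y` whose slices `{x} × Y → X ×_A Y`, `X × {y} → X ×_A Y` are affine morphisms, with proper
geometrically integral `κ`-fibres (Künneth) and with `R → Γ(X_R, 𝒪)`, `R → Γ(Y_R, 𝒪)` surjective for the Artinian quotients
`R = A/𝔪^{n+1}` (Stein).  Let `N` be a line bundle on `X ×_A Y` which is trivial on the two slices and on `(X ×_A Y) ⊗ A/𝔪`.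
Then `N` is trivial on `(X ×_A Y) ⊗ A/𝔪^{n+1}` for every `n` — [GortzWedhorn2023] Lemma 24.72, proof, Step (I) («we show by
induction on the length of `A` that `𝓔_{|X ⊗ A}` is trivial»), [MumfordAV1970] §6 (theorem of the cube, the deformation step).

HC_CM is proved only modulo the 7 printed citations until rung 0 closes; nothing here is about HC.

## References
* [GortzWedhorn2023] U. Görtz, T. Wedhorn, *Algebraic Geometry II* (2023), Lemma 24.72 proof Step (I) and (∗) (p. 409).
* [MumfordAV1970] D. Mumford, *Abelian Varieties* (1970), §6, the theorem of the cube (proof).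
* [Hartshorne2010] R. Hartshorne, *Deformation Theory*, GTM 257 (2010), §6 Thm. 6.4 (b) and proof (pp. 50–51).
-/

noncomputable section

universe u

open CategoryTheory CategoryTheory.Limits AlgebraicGeometry MonoidalCategory CartesianMonoidalCategory TensorProduct
open IsLocalRing
open Literature.AlgebraicGeometry.Morphisms Literature.AlgebraicGeometry.Morphisms.CechUnitCocycle
open Literature.AlgebraicGeometry.Modules Literature.RingTheory.Flat
open Literature.AlgebraicGeometry.AbelianSchemes.AbelianSchemeOver

namespace Literature.AlgebraicGeometry.Motives

variable {A : Type u} [CommRing A] [IsLocalRing A] [IsNoetherianRing A]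

/-- `(g₁ ≫ g₂)^*N` from `g₂^*N` pulled back along `g₁`, transported along an equality of composites `g₁ ≫ g₂ = g₁' ≫ g₂'`
(Mathlib `Scheme.Modules.pullbackComp`, `pullbackCongr`; private plumbing). [folklore] -/
private theorem nonempty_iso_pullback_pullback_of_comp_eq {Z₁ Z₂ Z₃ Z₂' : Scheme.{u}} (g₁ : Z₁ ⟶ Z₂) (g₂ : Z₂ ⟶ Z₃)
    (g₁' : Z₁ ⟶ Z₂') (g₂' : Z₂' ⟶ Z₃) (h : g₁ ≫ g₂ = g₁' ≫ g₂') (N : Z₃.Modules) :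
    Nonempty ((Scheme.Modules.pullback g₁).obj ((Scheme.Modules.pullback g₂).obj N) ≅
      (Scheme.Modules.pullback g₁').obj ((Scheme.Modules.pullback g₂').obj N)) :=
  ⟨(Scheme.Modules.pullbackComp g₁ g₂).app N ≪≫ (Scheme.Modules.pullbackCongr h).app N ≪≫
    ((Scheme.Modules.pullbackComp g₁' g₂').app N).symm⟩

/-- `appLE` along equal morphisms (private plumbing). [folklore] -/
private theorem appLE_congr {Z W : Scheme.{u}} {g g' : Z ⟶ W} (e : g = g') (U : W.Opens) (V : Z.Opens) (h : V ≤ g ⁻¹ᵁ U)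
    (h' : V ≤ g' ⁻¹ᵁ U) (s : Γ(W, U)) : g.appLE U V h s = g'.appLE U V h' s := by
  subst e; rfl

/-- **STEP (I) OF THE THEOREM OF THE CUBE OVER A NOETHERIAN LOCAL RING, FOR LINE BUNDLES** ([GortzWedhorn2023] Lemma 24.72 Step
(I), [MumfordAV1970] §6): see the module docstring.  Hypotheses: flatness of `X`, `Y`, `X ×_A Y` over `A`; `X ×_A Y` separated
over `Spec A` and quasi-compact; the slices through `x`, `y` affine morphisms; the `κ`-fibres of `X`, `Y` proper and geometrically
integral (Künneth ★ Č4e); `A/𝔪^{n+1} → Γ(X ⊗ A/𝔪^{n+1}, 𝒪)` and the same for `Y` surjective (Stein ★ Č4d); `N` of rank one,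
trivial on both slices and on the closed fibre `(X ×_A Y) ⊗ A/𝔪`.  Conclusion: `N` is trivial on `(X ×_A Y) ⊗ A/𝔪^{n+1}` for
all `n`. [cite: GortzWedhorn2023, Lemma 24.72 proof Step (I) (p. 409)] [cite: MumfordAV1970, §6 (theorem of the cube, proof)] -/
theorem cubeStepI_localRing (X Y : SchemeOver A) [Flat X.hom] [Flat Y.hom] [Flat (X ⊗ Y).hom]
    [IsSeparated (X ⊗ Y).hom] [CompactSpace (X ⊗ Y).left] (x : 𝟙_ (SchemeOver A) ⟶ X) (y : 𝟙_ (SchemeOver A) ⟶ Y)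
    [IsAffineHom ((λ_ Y).inv ≫ x ▷ Y).left] [IsAffineHom ((ρ_ X).inv ≫ X ◁ y).left]
    [hPX : IsProper ((Over.pullback (Spec.map (CommRingCat.ofHom (algebraMap A (ResidueField A))))).obj X).hom]
    [hPY : IsProper ((Over.pullback (Spec.map (CommRingCat.ofHom (algebraMap A (ResidueField A))))).obj Y).hom]
    [hGX : GeometricallyIntegral ((Over.pullback (Spec.map (CommRingCat.ofHom (algebraMap A (ResidueField A))))).obj X).hom]
    [hGY : GeometricallyIntegral ((Over.pullback (Spec.map (CommRingCat.ofHom (algebraMap A (ResidueField A))))).obj Y).hom]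
    (hStX : ∀ n : ℕ, Function.Surjective (toSectionsBase A
      (pullback.snd X.hom (Spec.map (CommRingCat.ofHom (algebraMap A (A ⧸ maximalIdeal A ^ (n + 1)))))) ⊤))
    (hStY : ∀ n : ℕ, Function.Surjective (toSectionsBase A
      (pullback.snd Y.hom (Spec.map (CommRingCat.ofHom (algebraMap A (A ⧸ maximalIdeal A ^ (n + 1)))))) ⊤))
    (N : (X ⊗ Y).left.Modules) (hN : HasRank N 1)
    (h₁ : Nonempty (unitModule _ ≅ (Scheme.Modules.pullback ((λ_ Y).inv ≫ x ▷ Y).left).obj N))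
    (h₂ : Nonempty (unitModule _ ≅ (Scheme.Modules.pullback ((ρ_ X).inv ≫ X ◁ y).left).obj N))
    (h0 : Nonempty (unitModule _ ≅ (Scheme.Modules.pullback
      (pullback.fst (X ⊗ Y).hom (Spec.map (CommRingCat.ofHom (algebraMap A (A ⧸ maximalIdeal A ^ (0 + 1))))))).obj N)) :
    ∀ n : ℕ, Nonempty (unitModule _ ≅ (Scheme.Modules.pullback
      (pullback.fst (X ⊗ Y).hom (Spec.map (CommRingCat.ofHom (algebraMap A (A ⧸ maximalIdeal A ^ (n + 1))))))).obj N) := by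
  -- (0) names: the levels `σ n : Spec (A/𝔪^{n+1}) → Spec A`, the transitions `π n : A/𝔪^{n+2} → A/𝔪^{n+1}`
  let σ : ∀ n : ℕ, Spec (.of (A ⧸ maximalIdeal A ^ (n + 1))) ⟶ Spec (.of A) := fun n =>
    Spec.map (CommRingCat.ofHom (algebraMap A (A ⧸ maximalIdeal A ^ (n + 1))))
  let π : ∀ n : ℕ, (A ⧸ maximalIdeal A ^ (n + 1 + 1)) →ₐ[A] (A ⧸ maximalIdeal A ^ (n + 1)) := fun n =>
    Ideal.Quotient.factorₐ A (Ideal.pow_le_pow_right (Nat.le_succ (n + 1)))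
  -- (1) the affine cover trivialising `N`, flat sections
  obtain ⟨ι, hι, U, hU, hU2, hU3, hcov, ⟨F⟩⟩ := exists_affine_cover_iframes (X ⊗ Y).hom N hN
  have hfl := forall_flat_sections_of_isAffineOpen (X ⊗ Y).hom
  have hflX := forall_flat_sections_of_isAffineOpen X.hom
  have hflY := forall_flat_sections_of_isAffineOpen Y.hom
  -- (2) the tower `A/𝔪^{n+1}` and the base changes `Z_n = (X ⊗ Y) ×_A Spec (A/𝔪^{n+1})`
  choose d e He using fun n => exists_isSmallExtension_powQuot A A n
  have HP : ∀ n : ℕ, IsPullback (pullback.fst (X ⊗ Y).hom (σ n))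
      (pullback.snd _ _) (X ⊗ Y).hom (σ n) :=
    fun n => IsPullback.of_hasPullback _ _
  have HPX : ∀ n : ℕ, IsPullback (pullback.fst X.hom (σ n))
      (pullback.snd _ _) X.hom (σ n) :=
    fun n => IsPullback.of_hasPullback _ _
  have HPY : ∀ n : ℕ, IsPullback (pullback.fst Y.hom (σ n))
      (pullback.snd _ _) Y.hom (σ n) :=
    fun n => IsPullback.of_hasPullback _ _
  -- model data of `Z_n` on `g_n⁻¹𝒰`
  choose Φ hΦ₁ hΦ₂ hΦ₃ using fun n => exists_modelData_of_isPullback (HP n) hU hU2 hU3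
  -- (3) the faces `jY₁ : Y = {x} × Y → X × Y`, `jY₂ : X = X × {y} → X × Y` and their covers
  have hj₁ : ((λ_ Y).inv ≫ x ▷ Y).left ≫ (X ⊗ Y).hom = Y.hom := Over.w _
  have hj₂ : ((ρ_ X).inv ≫ X ◁ y).left ≫ (X ⊗ Y).hom = X.hom := Over.w _
  have hUY₁ : ∀ a, IsAffineOpen (preimageFamily ((λ_ Y).inv ≫ x ▷ Y).left U a) := fun a => (hU a).preimage _
  have hUY2₁ : ∀ a b, IsAffineOpen (preimageFamily ((λ_ Y).inv ≫ x ▷ Y).left U a ⊓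
      preimageFamily ((λ_ Y).inv ≫ x ▷ Y).left U b) := fun a b => (hU2 a b).preimage _
  have hUY3₁ : ∀ a b c, IsAffineOpen (preimageFamily ((λ_ Y).inv ≫ x ▷ Y).left U a ⊓
      preimageFamily ((λ_ Y).inv ≫ x ▷ Y).left U b ⊓ preimageFamily ((λ_ Y).inv ≫ x ▷ Y).left U c) :=
    fun a b c => (hU3 a b c).preimage _
  have hUY₂ : ∀ a, IsAffineOpen (preimageFamily ((ρ_ X).inv ≫ X ◁ y).left U a) := fun a => (hU a).preimage _
  have hUY2₂ : ∀ a b, IsAffineOpen (preimageFamily ((ρ_ X).inv ≫ X ◁ y).left U a ⊓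
      preimageFamily ((ρ_ X).inv ≫ X ◁ y).left U b) := fun a b => (hU2 a b).preimage _
  have hUY3₂ : ∀ a b c, IsAffineOpen (preimageFamily ((ρ_ X).inv ≫ X ◁ y).left U a ⊓
      preimageFamily ((ρ_ X).inv ≫ X ◁ y).left U b ⊓ preimageFamily ((ρ_ X).inv ≫ X ◁ y).left U c) :=
    fun a b c => (hU3 a b c).preimage _
  have hcovY₁ : ⨆ a, preimageFamily ((λ_ Y).inv ≫ x ▷ Y).left U a = ⊤ := iSup_preimageFamily_eq_top _ U hcov
  have hcovY₂ : ⨆ a, preimageFamily ((ρ_ X).inv ≫ X ◁ y).left U a = ⊤ := iSup_preimageFamily_eq_top _ U hcov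
  choose ΦY₁ hΦY₁1 hΦY₁2 hΦY₁3 using fun n => exists_modelData_of_isPullback (U := preimageFamily ((λ_ Y).inv ≫ x ▷ Y).left U)
    (HPY n) hUY₁ hUY2₁ hUY3₁
  choose ΦY₂ hΦY₂1 hΦY₂2 hΦY₂3 using fun n => exists_modelData_of_isPullback (U := preimageFamily ((ρ_ X).inv ≫ X ◁ y).left U)
    (HPX n) hUY₂ hUY2₂ hUY3₂
  -- the face maps at level `n` and their squares
  have hsq₁ : ∀ n : ℕ, ((Over.pullback (σ n)).map
      ((λ_ Y).inv ≫ x ▷ Y)).left ≫ pullback.fst (X ⊗ Y).hom _ = pullback.fst Y.hom _ ≫ ((λ_ Y).inv ≫ x ▷ Y).left := fun n => by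
    simp only [Over.pullback, Over.homMk_left]
    exact pullback.lift_fst _ _ _
  have hsq₂ : ∀ n : ℕ, ((Over.pullback (σ n)).map
      ((ρ_ X).inv ≫ X ◁ y)).left ≫ pullback.fst (X ⊗ Y).hom _ = pullback.fst X.hom _ ≫ ((ρ_ X).inv ≫ X ◁ y).left := fun n => by
    simp only [Over.pullback, Over.homMk_left]
    exact pullback.lift_fst _ _ _
  -- (4) transitions `τ_n : Z_n → Z_{n+1}`
  have hσ : ∀ n : ℕ, Spec.map (CommRingCat.ofHom (π n).toRingHom) ≫ σ (n + 1) = σ n := fun n =>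
    Spec_map_algHom_comp (π n)
  have hτ : ∀ n : ℕ, ∃ τ : pullback (X ⊗ Y).hom (σ n) ⟶ pullback (X ⊗ Y).hom (σ (n + 1)),
      τ ≫ pullback.fst _ _ = pullback.fst _ _ ∧ τ ≫ pullback.snd _ _ = pullback.snd _ _ ≫ Spec.map (CommRingCat.ofHom (π n).toRingHom) :=
    fun n => ⟨pullback.lift (pullback.fst _ _) (pullback.snd _ _ ≫ Spec.map (CommRingCat.ofHom (π n).toRingHom))
      (by rw [Category.assoc, hσ n]; exact pullback.condition), pullback.lift_fst _ _ _, pullback.lift_snd _ _ _⟩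
  choose τ hτg hτf using hτ
  -- the model cocycles `u_n` of `N|_{Z_n}` form a compatible tower
  have hu : ∀ (n : ℕ) (a b : ι), ((Φ n).cocycle (F.pullback (pullback.fst (X ⊗ Y).hom (σ n)))).val a b =
      coef (X ⊗ Y).hom (π n) _ (((Φ (n + 1)).cocycle (F.pullback (pullback.fst (X ⊗ Y).hom (σ (n + 1))))).val a b) := by
    intro n a b
    have hHom := modelData_hom_of_isPullback (HP (n + 1)).w (HP n).w (π n) (τ n) (hτf n) (hτg n)
      (Φ (n + 1)) (hΦ₂ (n + 1)) (Φ n) (hΦ₂ n)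
    apply ((Φ n).Φ₂ a b).injective
    rw [ModelData.cocycle_val, RingEquiv.apply_symm_apply, hHom.Φ₂_coef, ModelData.cocycle_val,
      RingEquiv.apply_symm_apply, IFrames.tf_pullback, IFrames.tf_pullback, ← CommRingCat.comp_apply,
      Scheme.Hom.appLE_comp_appLE]
    exact appLE_congr (hτg n).symm _ _ _ _ _
  -- (5) the face restrictions at each level: squares, frames, cocycles, triviality
  have hjR₁ : ∀ n : ℕ, ((Over.pullback (σ n)).map ((λ_ Y).inv ≫ x ▷ Y)).left ≫ pullback.snd (X ⊗ Y).hom (σ n) =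
      pullback.snd Y.hom (σ n) := fun n => Over.w _
  have hjR₂ : ∀ n : ℕ, ((Over.pullback (σ n)).map ((ρ_ X).inv ≫ X ◁ y)).left ≫ pullback.snd (X ⊗ Y).hom (σ n) =
      pullback.snd X.hom (σ n) := fun n => Over.w _
  have hW₁ : ∀ n : ℕ, (fun a => ((Over.pullback (σ n)).map ((λ_ Y).inv ≫ x ▷ Y)).left ⁻¹ᵁ
      (pullback.fst (X ⊗ Y).hom (σ n) ⁻¹ᵁ U a)) =
      preimageFamily (pullback.fst Y.hom (σ n)) (preimageFamily ((λ_ Y).inv ≫ x ▷ Y).left U) := fun n => by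
    funext a
    change (((Over.pullback (σ n)).map ((λ_ Y).inv ≫ x ▷ Y)).left ≫ pullback.fst (X ⊗ Y).hom (σ n)) ⁻¹ᵁ U a =
      (pullback.fst Y.hom (σ n) ≫ ((λ_ Y).inv ≫ x ▷ Y).left) ⁻¹ᵁ U a
    rw [hsq₁ n]
    rfl
  have hW₂ : ∀ n : ℕ, (fun a => ((Over.pullback (σ n)).map ((ρ_ X).inv ≫ X ◁ y)).left ⁻¹ᵁ
      (pullback.fst (X ⊗ Y).hom (σ n) ⁻¹ᵁ U a)) =
      preimageFamily (pullback.fst X.hom (σ n)) (preimageFamily ((ρ_ X).inv ≫ X ◁ y).left U) := fun n => by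
    funext a
    change (((Over.pullback (σ n)).map ((ρ_ X).inv ≫ X ◁ y)).left ≫ pullback.fst (X ⊗ Y).hom (σ n)) ⁻¹ᵁ U a =
      (pullback.fst X.hom (σ n) ≫ ((ρ_ X).inv ≫ X ◁ y).left) ⁻¹ᵁ U a
    rw [hsq₂ n]
    rfl
  have hle₁ : ∀ (n : ℕ) (a b : ι),
      preimageFamily (pullback.fst Y.hom (σ n)) (preimageFamily ((λ_ Y).inv ≫ x ▷ Y).left U) a ⊓
        preimageFamily (pullback.fst Y.hom (σ n)) (preimageFamily ((λ_ Y).inv ≫ x ▷ Y).left U) b ≤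
      ((Over.pullback (σ n)).map ((λ_ Y).inv ≫ x ▷ Y)).left ⁻¹ᵁ
        (preimageFamily (pullback.fst (X ⊗ Y).hom (σ n)) U a ⊓ preimageFamily (pullback.fst (X ⊗ Y).hom (σ n)) U b) := by
    intro n a b
    have ha := congrFun (hW₁ n) a
    have hb := congrFun (hW₁ n) b
    rw [← ha, ← hb]
    exact le_rfl
  have hle₂ : ∀ (n : ℕ) (a b : ι),
      preimageFamily (pullback.fst X.hom (σ n)) (preimageFamily ((ρ_ X).inv ≫ X ◁ y).left U) a ⊓
        preimageFamily (pullback.fst X.hom (σ n)) (preimageFamily ((ρ_ X).inv ≫ X ◁ y).left U) b ≤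
      ((Over.pullback (σ n)).map ((ρ_ X).inv ≫ X ◁ y)).left ⁻¹ᵁ
        (preimageFamily (pullback.fst (X ⊗ Y).hom (σ n)) U a ⊓ preimageFamily (pullback.fst (X ⊗ Y).hom (σ n)) U b) := by
    intro n a b
    have ha := congrFun (hW₂ n) a
    have hb := congrFun (hW₂ n) b
    rw [← ha, ← hb]
    exact le_rfl
  -- frames of the face restrictions
  let G₁ : ∀ n : ℕ, IFrames ((Scheme.Modules.pullback ((Over.pullback (σ n)).map ((λ_ Y).inv ≫ x ▷ Y)).left).obj
      ((Scheme.Modules.pullback (pullback.fst (X ⊗ Y).hom (σ n))).obj N))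
      (preimageFamily (pullback.fst Y.hom (σ n)) (preimageFamily ((λ_ Y).inv ≫ x ▷ Y).left U)) := fun n =>
    ((F.pullback (pullback.fst (X ⊗ Y).hom (σ n))).pullback ((Over.pullback (σ n)).map ((λ_ Y).inv ≫ x ▷ Y)).left).cast (hW₁ n)
  let G₂ : ∀ n : ℕ, IFrames ((Scheme.Modules.pullback ((Over.pullback (σ n)).map ((ρ_ X).inv ≫ X ◁ y)).left).obj
      ((Scheme.Modules.pullback (pullback.fst (X ⊗ Y).hom (σ n))).obj N))
      (preimageFamily (pullback.fst X.hom (σ n)) (preimageFamily ((ρ_ X).inv ≫ X ◁ y).left U)) := fun n =>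
    ((F.pullback (pullback.fst (X ⊗ Y).hom (σ n))).pullback ((Over.pullback (σ n)).map ((ρ_ X).inv ≫ X ◁ y)).left).cast (hW₂ n)
  have hG₁ : ∀ (n : ℕ) (a b : ι), (G₁ n).tf a b = ((Over.pullback (σ n)).map ((λ_ Y).inv ≫ x ▷ Y)).left.appLE _ _ (hle₁ n a b)
      ((F.pullback (pullback.fst (X ⊗ Y).hom (σ n))).tf a b) := fun n a b => by
    change (((F.pullback (pullback.fst (X ⊗ Y).hom (σ n))).pullback _).cast (hW₁ n)).tf a b = _
    rw [IFrames.tf_cast, IFrames.tf_pullback, ← CommRingCat.comp_apply, Scheme.Hom.appLE_map]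
    rfl
  have hG₂ : ∀ (n : ℕ) (a b : ι), (G₂ n).tf a b = ((Over.pullback (σ n)).map ((ρ_ X).inv ≫ X ◁ y)).left.appLE _ _ (hle₂ n a b)
      ((F.pullback (pullback.fst (X ⊗ Y).hom (σ n))).tf a b) := fun n a b => by
    change (((F.pullback (pullback.fst (X ⊗ Y).hom (σ n))).pullback _).cast (hW₂ n)).tf a b = _
    rw [IFrames.tf_cast, IFrames.tf_pullback, ← CommRingCat.comp_apply, Scheme.Hom.appLE_map]
    rfl
  -- the face cocycles are the restrictions of `u_n`
  have huY₁ := fun (n : ℕ) (a b : ι) => cocycle_val_eq_map_comap_of_face hj₁ (HP n).w (HPY n).w (hjR₁ n) (hsq₁ n) (Φ n) (hΦ₂ n)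
    (ΦY₁ n) (hΦY₁2 n) (F.pullback (pullback.fst (X ⊗ Y).hom (σ n))) (G₁ n) (hle₁ n) (hG₁ n) a b
  have huY₂ := fun (n : ℕ) (a b : ι) => cocycle_val_eq_map_comap_of_face hj₂ (HP n).w (HPX n).w (hjR₂ n) (hsq₂ n) (Φ n) (hΦ₂ n)
    (ΦY₂ n) (hΦY₂2 n) (F.pullback (pullback.fst (X ⊗ Y).hom (σ n))) (G₂ n) (hle₂ n) (hG₂ n) a b
  -- (6) the trivial cocycles as model cocycles of the unit frames; face and level-0 trivialities
  have hψ₁ : ∀ n : ℕ, Nonempty (unitModule _ ≅ (Scheme.Modules.pullback ((Over.pullback (σ n)).map ((λ_ Y).inv ≫ x ▷ Y)).left).obj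
      ((Scheme.Modules.pullback (pullback.fst (X ⊗ Y).hom (σ n))).obj N)) := fun n => by
    obtain ⟨e1⟩ := nonempty_iso_pullback_pullback_of_comp_eq ((Over.pullback (σ n)).map ((λ_ Y).inv ≫ x ▷ Y)).left
      (pullback.fst (X ⊗ Y).hom (σ n)) (pullback.fst Y.hom (σ n)) ((λ_ Y).inv ≫ x ▷ Y).left (hsq₁ n) N
    obtain ⟨ψ⟩ := h₁
    exact ⟨(RigidifiedLineBundle.pullbackUnitIso (pullback.fst Y.hom (σ n))).symm ≪≫
      (Scheme.Modules.pullback (pullback.fst Y.hom (σ n))).mapIso ψ ≪≫ e1.symm⟩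
  have hψ₂ : ∀ n : ℕ, Nonempty (unitModule _ ≅ (Scheme.Modules.pullback ((Over.pullback (σ n)).map ((ρ_ X).inv ≫ X ◁ y)).left).obj
      ((Scheme.Modules.pullback (pullback.fst (X ⊗ Y).hom (σ n))).obj N)) := fun n => by
    obtain ⟨e1⟩ := nonempty_iso_pullback_pullback_of_comp_eq ((Over.pullback (σ n)).map ((ρ_ X).inv ≫ X ◁ y)).left
      (pullback.fst (X ⊗ Y).hom (σ n)) (pullback.fst X.hom (σ n)) ((ρ_ X).inv ≫ X ◁ y).left (hsq₂ n) N
    obtain ⟨ψ⟩ := h₂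
    exact ⟨(RigidifiedLineBundle.pullbackUnitIso (pullback.fst X.hom (σ n))).symm ≪≫
      (Scheme.Modules.pullback (pullback.fst X.hom (σ n))).mapIso ψ ≪≫ e1.symm⟩
  choose g₁ hg₁ using fun n => (ΦY₁ n).rel_cocycle_of_iso
    (⟨fun a => freePUnitIso _⟩ : IFrames (unitModule _) (preimageFamily (pullback.fst Y.hom (σ n))
      (preimageFamily ((λ_ Y).inv ≫ x ▷ Y).left U))) (G₁ n) (hψ₁ n).some
  choose g₂ hg₂ using fun n => (ΦY₂ n).rel_cocycle_of_iso
    (⟨fun a => freePUnitIso _⟩ : IFrames (unitModule _) (preimageFamily (pullback.fst X.hom (σ n))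
      (preimageFamily ((ρ_ X).inv ≫ X ◁ y).left U))) (G₂ n) (hψ₂ n).some
  obtain ⟨h₀, hr₀⟩ := (Φ 0).rel_cocycle_of_iso
    (⟨fun a => freePUnitIso _⟩ : IFrames (unitModule _) (preimageFamily (pullback.fst (X ⊗ Y).hom (σ 0)) U))
    (F.pullback (pullback.fst (X ⊗ Y).hom (σ 0))) h0.some
  -- (7) Künneth and Stein on the residue fibre / Artinian levels
  have hsqκ₁ : ((Over.pullback (Spec.map (CommRingCat.ofHom (algebraMap A (ResidueField A))))).map
      ((λ_ Y).inv ≫ x ▷ Y)).left ≫ pullback.fst (X ⊗ Y).hom _ = pullback.fst Y.hom _ ≫ ((λ_ Y).inv ≫ x ▷ Y).left := by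
    simp only [Over.pullback, Over.homMk_left]
    exact pullback.lift_fst _ _ _
  have hsqκ₂ : ((Over.pullback (Spec.map (CommRingCat.ofHom (algebraMap A (ResidueField A))))).map
      ((ρ_ X).inv ≫ X ◁ y)).left ≫ pullback.fst (X ⊗ Y).hom _ = pullback.fst X.hom _ ≫ ((ρ_ X).inv ≫ X ◁ y).left := by
    simp only [Over.pullback, Over.homMk_left]
    exact pullback.lift_fst _ _ _
  have hSt₁ := fun (n : ℕ) (c : UCochain0 Y.hom (preimageFamily ((λ_ Y).inv ≫ x ▷ Y).left U) (A ⧸ maximalIdeal A ^ (n + 1))) hc =>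
    exists_eq_one_tmul_units_of_surjective_toSectionsBase (HPY n) hUY₁ hcovY₁ (hStY n) c hc
  have hSt₂ := fun (n : ℕ) (c : UCochain0 X.hom (preimageFamily ((ρ_ X).inv ≫ X ◁ y).left U) (A ⧸ maximalIdeal A ^ (n + 1))) hc =>
    exists_eq_one_tmul_units_of_surjective_toSectionsBase (HPX n) hUY₂ hcovY₂ (hStX n) c hc
  -- (8) the tower
  have main := forall_exists_rel_of_tower (f := (X ⊗ Y).hom) (U := U) (k := ResidueField A) He
    (factorₐ_residue_comp_factorₐ A A) hfl hU hU2 hU3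
    (IsPullback.of_hasPullback (X ⊗ Y).hom (Spec.map (CommRingCat.ofHom (algebraMap A (ResidueField A)))))
    hj₁ hflY hUY2₁ hUY3₁ (IsPullback.of_hasPullback Y.hom (Spec.map (CommRingCat.ofHom (algebraMap A (ResidueField A))))).w
    (Over.w ((Over.pullback (Spec.map (CommRingCat.ofHom (algebraMap A (ResidueField A))))).map ((λ_ Y).inv ≫ x ▷ Y)))
    hsqκ₁
    hj₂ hflX hUY2₂ hUY3₂ (IsPullback.of_hasPullback X.hom (Spec.map (CommRingCat.ofHom (algebraMap A (ResidueField A))))).w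
    (Over.w ((Over.pullback (Spec.map (CommRingCat.ofHom (algebraMap A (ResidueField A))))).map ((ρ_ X).inv ≫ X ◁ y)))
    hsqκ₂
    (fun c hx hy => @eq_zero_of_cechComapH1_pullback_slices_eq_zero A _ (ResidueField A) _ _ X Y hPX hPY hGX hGY x y ι U hU
      hcov _ rfl _ rfl _ rfl c hx hy)
    hSt₁ hSt₂
    (fun n => (Φ n).cocycle (⟨fun a => freePUnitIso _⟩ : IFrames (unitModule _) (preimageFamily (pullback.fst (X ⊗ Y).hom (σ n)) U)))
    (fun n a b => by rw [ModelData.cocycle_val, IFrames.tf_unitFrames, map_one])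
    (fun n => (Φ n).cocycle (F.pullback (pullback.fst (X ⊗ Y).hom (σ n)))) hu
    (fun n => (ΦY₁ n).cocycle (⟨fun a => freePUnitIso _⟩ : IFrames (unitModule _) (preimageFamily (pullback.fst Y.hom (σ n))
      (preimageFamily ((λ_ Y).inv ≫ x ▷ Y).left U))))
    (fun n a b => by rw [ModelData.cocycle_val, IFrames.tf_unitFrames, map_one])
    (fun n => (ΦY₁ n).cocycle (G₁ n)) huY₁ g₁ hg₁
    (fun n => (ΦY₂ n).cocycle (⟨fun a => freePUnitIso _⟩ : IFrames (unitModule _) (preimageFamily (pullback.fst X.hom (σ n))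
      (preimageFamily ((ρ_ X).inv ≫ X ◁ y).left U))))
    (fun n a b => by rw [ModelData.cocycle_val, IFrames.tf_unitFrames, map_one])
    (fun n => (ΦY₂ n).cocycle (G₂ n)) huY₂ g₂ hg₂ ⟨h₀, hr₀⟩
  -- (9) read back: `N|_{Z_n} ≅ 𝒪`
  intro n
  obtain ⟨h, hr⟩ := main n
  exact (Φ n).nonempty_iso_of_rel (iSup_preimageFamily_eq_top _ U hcov)
    (⟨fun a => freePUnitIso _⟩ : IFrames (unitModule _) (preimageFamily (pullback.fst (X ⊗ Y).hom (σ n)) U))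
    (F.pullback (pullback.fst (X ⊗ Y).hom (σ n))) (fun a => (h a : _)) (fun a => (h a).isUnit) hr

end Literature.AlgebraicGeometry.Motives

end
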